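import Mathlib
import HarnessLib

/-!
# Ordered products with central plaquettes: the ladder and column identities (non-abelian Stokes on a torus slice, algebra)
# (route-independent helper toward the crux `TwistExponentGap.RigidTwistCeiling` ⟨stmt-QuantumFields-24054⟩; free hands of
# width seat ym-line-sfw-p2-w3)

Pure group theory behind the remaining group-level step (W1) of ⟨24054⟩ («pair-rigidity ⇒ the gauge stabiliser of a `z`-twisted
flat configuration is finite», cf. `TwistExponentGapCovConstOfFiniteStabilizer`): on an `S × S` torus slice all of whose
plaquette holonomies are CENTRAL (a twisted-flat configuration has plaquettes `1` or `z⁻¹`), the row holonomy `a` and the column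
holonomy `b` through the corner satisfy `a·b = C·b·a` with `C` the ordered product of all plaquettes — so with exactly one
plaquette `z⁻¹` the pair `(b, a)` has commutator `z`.  Three list-product identities, each a one-line induction:
* `prod_ladder` — moving a vertical link through a row: `(∏_{i<n} u_i)·v_n = (∏_{i<n} P_i)·v_0·(∏_{i<n} u'_i)` when
  `u_i v_{i+1} = P_i v_i u'_i` with `P_i` central (one plaquette at a time);
* `prod_column` — stacking rows: `R_0·(∏_{j<m} w_j) = (∏_{j<m} c_j)·(∏_{j<m} w_j)·R_m` when `R_j w_j = c_j w_j R_{j+1}`, `c_j` central;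
* `prod_map_ite_zero` — `∏_{i<n} (if i = 0 then a else 1) = a` for `n ≥ 1`;
and the commutator bookkeeping `comm_eq_of_mul_eq` (`a b = z⁻¹ b a ⇒ b a b⁻¹ a⁻¹ = z`).
HONEST FRAMING: elementary; nothing here bears on a summit statement or on the Yang–Mills mass gap.
-/

set_option autoImplicit false

namespace Summit.QuantumFields.YangMills.Theorems.TwistExponentGap

variable {G : Type*} [Group G]

/-- **Ladder identity.** If `u_i · v_{i+1} = P_i · v_i · u'_i` with `P_i` central, then
`(u_0 ⋯ u_{n-1}) · v_n = (P_0 ⋯ P_{n-1}) · v_0 · (u'_0 ⋯ u'_{n-1})`. -/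
theorem prod_ladder (u u' v P : ℕ → G) (hP : ∀ n, P n ∈ Subgroup.center G)
    (h : ∀ n, u n * v (n + 1) = P n * v n * u' n) (n : ℕ) :
    ((List.range n).map u).prod * v n = ((List.range n).map P).prod * v 0 * ((List.range n).map u').prod := by
  induction n with
  | zero => simp
  | succ n ih =>
    simp only [List.range_succ, List.map_append, List.map_singleton, List.prod_append, List.prod_singleton]
    have hc : ∀ g : G, g * P n = P n * g := fun g => (Subgroup.mem_center_iff.1 (hP n) g)
    calc ((List.range n).map u).prod * u n * v (n + 1)
        = ((List.range n).map u).prod * (u n * v (n + 1)) := by rw [mul_assoc]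
      _ = ((List.range n).map u).prod * (P n * v n * u' n) := by rw [h n]
      _ = P n * (((List.range n).map u).prod * v n) * u' n := by
          rw [← mul_assoc, ← mul_assoc, hc]; simp only [mul_assoc]
      _ = P n * (((List.range n).map P).prod * v 0 * ((List.range n).map u').prod) * u' n := by rw [ih]
      _ = ((List.range n).map P).prod * P n * v 0 * (((List.range n).map u').prod * u' n) := by
          rw [hc (((List.range n).map P).prod)]; simp only [mul_assoc]

/-- **Column identity.** If `R_j · w_j = c_j · w_j · R_{j+1}` with `c_j` central, then
`R_0 · (w_0 ⋯ w_{m-1}) = (c_0 ⋯ c_{m-1}) · (w_0 ⋯ w_{m-1}) · R_m`. -/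
theorem prod_column (R w c : ℕ → G) (hc : ∀ j, c j ∈ Subgroup.center G)
    (h : ∀ j, R j * w j = c j * w j * R (j + 1)) (m : ℕ) :
    R 0 * ((List.range m).map w).prod = ((List.range m).map c).prod * ((List.range m).map w).prod * R m := by
  induction m with
  | zero => simp
  | succ m ih =>
    simp only [List.range_succ, List.map_append, List.map_singleton, List.prod_append, List.prod_singleton]
    have hcc : ∀ g : G, g * c m = c m * g := fun g => (Subgroup.mem_center_iff.1 (hc m) g)
    calc R 0 * (((List.range m).map w).prod * w m)
        = R 0 * ((List.range m).map w).prod * w m := by rw [mul_assoc]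
      _ = ((List.range m).map c).prod * ((List.range m).map w).prod * R m * w m := by rw [ih]
      _ = ((List.range m).map c).prod * ((List.range m).map w).prod * (R m * w m) := by simp only [mul_assoc]
      _ = ((List.range m).map c).prod * ((List.range m).map w).prod * (c m * w m * R (m + 1)) := by rw [h m]
      _ = ((List.range m).map c).prod * (((List.range m).map w).prod * c m) * w m * R (m + 1) := by
          simp only [mul_assoc]
      _ = ((List.range m).map c).prod * (c m * ((List.range m).map w).prod) * w m * R (m + 1) := by
          rw [hcc (((List.range m).map w).prod)]
      _ = ((List.range m).map c).prod * c m * (((List.range m).map w).prod * w m) * R (m + 1) := by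
          simp only [mul_assoc]

/-- `∏_{i<n} (if i = 0 then a else 1) = a` for `n ≥ 1`. -/
theorem prod_map_ite_zero (a : G) {n : ℕ} (hn : 1 ≤ n) :
    ((List.range n).map fun i => if i = 0 then a else 1).prod = a := by
  induction n with
  | zero => omega
  | succ n ih =>
    rcases Nat.eq_zero_or_pos n with h0 | hpos
    · subst h0; simp
    · rw [List.range_succ, List.map_append, List.prod_append, ih hpos]
      simp [Nat.pos_iff_ne_zero.1 hpos]

/-- All-ones product: `∏_{i<n} (if P i then 1 else 1)`-type bookkeeping — if every factor is `1` the product is `1`. -/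
theorem prod_map_eq_one {f : ℕ → G} {n : ℕ} (h : ∀ i, i < n → f i = 1) : ((List.range n).map f).prod = 1 := by
  apply List.prod_eq_one
  intro x hx
  rw [List.mem_map] at hx
  obtain ⟨i, hi, rfl⟩ := hx
  exact h i (List.mem_range.1 hi)

/-- Commutator bookkeeping: `a b = z⁻¹ b a` gives `b a b⁻¹ a⁻¹ = z`. -/
theorem comm_eq_of_mul_eq {a b z : G} (h : a * b = z⁻¹ * (b * a)) : b * a * b⁻¹ * a⁻¹ = z := by
  have h2 : b * a = z * (a * b) := by rw [h, ← mul_assoc, mul_inv_cancel, one_mul]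
  rw [h2]; group

end Summit.QuantumFields.YangMills.Theorems.TwistExponentGap
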